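import Literature.Geometry.Kaehler.ComplexTorusHodgeLieAlgebraProductsPowers
import Literature.Geometry.Kaehler.ComplexTorusHodgeLieAlgebraCommutativeDimension
import Literature.Geometry.Kaehler.ComplexTorusHodgeGroupProductCMEllipticCurves
import Literature.Geometry.Kaehler.ComplexTorusHodgeGroupPiEllipticCurves
import Literature.Geometry.Kaehler.ComplexTorusPicardNumberFiniteProduct
import HarnessLib

/-!
# The Hodge Lie algebra of a product with product Hodge group, and the abelian surfaces `E × E'`:
# `(dim 𝔨, dim 𝔭)(E_τ₁ × E_τ₂) = (2, 0), (2, 2), (2, 4)` for the non-isogenous CM × CM, non-CM × CM,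
# non-CM × non-CM products (`dim 𝔥𝔤_ℝ = 2, 4, 6`: the types `𝔲(1)²`, `𝔲(1) ⊕ 𝔰𝔩₂(ℝ)`, `𝔰𝔩₂(ℝ)²`)

[cite: Imai1976HodgeGroups, §1 (p. 367) and §2 Proposition (pp. 368–370)] [cite: MoonenZarhin1999LowDim, §3 Theorem and Corollary]
[cite: FiteEtAl2012, §3.2 Lemma 3.7 and §4.2] [cite: GreenGriffithsKerr2012, §III.B (i) (p. 72)]

Layer `Literature/Geometry/Kaehler`, namespace `Literature.Geometry.Kaehler.ComplexTorus`; lane `lit-hodgefound`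
(Track 2 foundations library), Layer A, prover seat p17 (generation 20), self-proposed row g20-#2 of
`run/shared/lean/pub/lit-hodgefound/SKELETON.md` — the EXISTENCE half, for the product types, of the dimension table of
row g20-#1 (`ComplexTorusHodgeLieAlgebraAbelianSurfaces`: for every abelian surface
`(dim 𝔨, dim 𝔭) ∈ {(1,0), (1,2), (2,0), (2,2), (2,4)} ∪ {4} × {2,4,6}`; its §4 realised `(1,0)`, `(1,2)` by `E_i²`, `E_τ²`).
Sequel, BY NAME, of `ComplexTorusHodgeLieAlgebraProductsPowers` (p17 g17-#4: `𝔥𝔤_ℝ(X₁ × X₂) ⊆ 𝔥𝔤_ℝ(X₁) ⊕ 𝔥𝔤_ℝ(X₂)`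
block-diagonally, `exists_eq_fromBlocks_of_mem_hodgeGroupLie_prod`, `finrank_hodgeGroupLie_prod_le`), of the PRODUCT HODGE
GROUP theorems `Hg(E_τ₁ × E_τ₂) = Hg(E_τ₁) × Hg(E_τ₂)` of `ComplexTorusHodgeGroupProductCMEllipticCurves`
(`hodgeGroup_prod_ellipticPeriod_eq_of_not_isIsogenous`: two non-isogenous CM curves),
`ComplexTorusHodgeGroupProductNonCMEllipticCurve` (`hodgeGroup_prod_ellipticPeriod_eq_of_eq_bot_of_ne_bot`,
`…_of_ne_bot_of_eq_bot`: one factor with, one without complex multiplication) and `ComplexTorusHodgeGroupProductNonCMEllipticCurves`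
(`hodgeGroup_prod_eq_of_homRat_eq_bot`, `homRat_ellipticPeriod_eq_bot_of_not_isIsogenous`: two non-isogenous curves without
complex multiplication), of `ComplexTorusEllipticCurveHodgeLieAlgebra` (p17 g17-#2: `dim 𝔥𝔤_ℝ(E_τ) = 1` or `3`),
`ComplexTorusHodgeLieAlgebraCartanPTrivial` (g18-#2 + rider: `dim 𝔥𝔤_ℝ = dim 𝔨 + dim 𝔭`, `dim 𝔨 ≥ 1`, `𝔭(E_τ) ≠ 0` without CM,
`𝔭 ≠ 0 ⟹ dim 𝔭 ≥ 2`), `ComplexTorusEndomorphismAlgebraProduct` (`jMatrix_prodPeriod`: `J_{X₁ × X₂} = J₁ ⊕ J₂`),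
`ComplexTorusHodgeGroupProduct` (`blockDiag`, `coe_blockDiag`), p24's `Literature.LinearAlgebra.Matrix.exp_fromBlocks_zero`,
and the explicit curves of `ComplexTorusHodgeGroupPiEllipticCurves` / `ComplexTorusPicardNumberFiniteProduct`
(`ellipticEnd_I_mul_sqrt_sqrt_eq_bot`, `not_isIsogenous_ellipticPeriod_I_mul_sqrt_sqrt_two_three`,
`not_isIsogenous_ellipticPeriod_I_mul_sqrt`, `ellipticEnd_I_mul_sqrt_sqrt_two_eq_bot`).  THEOREMS ONLY: no definition, no
named fact, no instance attribute (the commutator `LieRing.ofAssociativeRing` is bound by `letI` inside proofs), net debt 0;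
imports only modules whose build is available.

## The mathematics and its sources, quoted

Imai: "`Hg(A₁ × A₂) ⊂ Hg(A₁) × Hg(A₂)`" [Imai1976HodgeGroups, §1 (p. 367)] and "**Proposition.** Let `Eᵢ = V_{iR}/Lᵢ`
(`i = 1, 2, …, n`) be non-isogenous elliptic curves, then `Hg(E₁ × ⋯ × E_n) = Hg(E₁) × ⋯ × Hg(E_n)`"; "`Hg(E)` is a
1-dimensional torus if `E` is of CM-type, … `Hg(E) = SL₂` if `E` is not of CM-type" [ibid., §2 (p. 368)]; Moonen–Zarhin:
"**Corollary.** Let `X₁, …, X_n` be elliptic curves over `ℂ`, no two of which are isogenous. Write `X = X₁ × ⋯ × X_n`. Then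
`Hg(X) = Hg(X₁) × ⋯ × Hg(X_n)`" [MoonenZarhin1999LowDim, §3]; Green–Griffiths–Kerr: "(i) `M_{φ₁+φ₂} ⊂ M_{φ₁} × M_{φ₂}`"
[GreenGriffithsKerr2012, §III.B (p. 72)].  Fité–Kedlaya–Rotger–Sutherland list the connected Sato–Tate groups of abelian
surfaces as "`U(1)`, `SU(2)`, `U(1) × U(1)`, `U(1) × SU(2)`, `SU(2) × SU(2)`, `USp(4)`" [FiteEtAl2012, §3.2 Lemma 3.7], realised
[Kedlaya, *Sato–Tate groups of genus 2 curves*, arXiv:1408.6968, Thm. 3.1] by "`E₁ × E₁, E₂ × E₂, E₁ × E'₁, E₁ × E₂,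
E₂ × E'₂, A`" for non-isogenous `E₁, E'₁` with and `E₂, E'₂` without complex multiplication.

INFINITESIMALLY: for complex tori `X₁, X₂` with `Hg(X₁ × X₂) = Hg(X₁) × Hg(X₂)` (block-diagonally), the one-parameter
group `(e^{tA} 0; 0 e^{tB})` lies in `Hg(X₁ × X₂)(ℝ)` for `A ∈ 𝔥𝔤_ℝ(X₁)`, `B ∈ 𝔥𝔤_ℝ(X₂)`, so `𝔥𝔤_ℝ(X₁ × X₂) = 𝔥𝔤_ℝ(X₁) ⊕ 𝔥𝔤_ℝ(X₂)`
and `dim 𝔥𝔤_ℝ(X₁ × X₂) = dim 𝔥𝔤_ℝ(X₁) + dim 𝔥𝔤_ℝ(X₂)`; since `J_{X₁ × X₂} = J₁ ⊕ J₂`, UNCONDITIONALLY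
`𝔨(X₁ × X₂) ⊆ 𝔨(X₁) ⊕ 𝔨(X₂)` and `𝔭(X₁ × X₂) ⊆ 𝔭(X₁) ⊕ 𝔭(X₂)`, with equality of dimensions under the product hypothesis
(the totals agree).  For elliptic curves `(dim 𝔨, dim 𝔭, dim 𝔥𝔤_ℝ)(E_τ) = (1, 0, 1)` with and `(1, 2, 3)` without complex
multiplication; hence for EVERY product of two elliptic curves `dim 𝔨 ≤ 2`, `dim 𝔭 ≤ 4` (no `𝔲(2)` isotropy, never
Hodge-general), and for the three product cases of Imai's Proposition
`(dim 𝔨, dim 𝔭, dim 𝔥𝔤_ℝ)(E_τ₁ × E_τ₂) = (2, 0, 2)` (CM × CM, `E_τ₁ ≁ E_τ₂`), `(2, 2, 4)` (non-CM × CM, any), `(2, 4, 6)`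
(non-CM × non-CM, `E_τ₁ ≁ E_τ₂`) — explicitly `E_{i√2} × E_{i√3}`, `E_{i·2^{1/4}} × E_i`, `E_{i·2^{1/4}} × E_{i·3^{1/4}}`.

## What is proved

§1 (any two tori) `exists_eq_fromBlocks_of_mem_hodgeIsotropyLie_prod`, `exists_eq_fromBlocks_of_mem_hodgeCartanP_prod`,
**`finrank_hodgeIsotropyLie_prod_le`**, **`finrank_hodgeCartanP_prod_le`**; under `Hg(X₁ × X₂) = Hg(X₁) × Hg(X₂)`:
**`fromBlocks_mem_hodgeGroupLie_prod_of_hodgeGroup_eq`**, **`finrank_hodgeGroupLie_prod_eq_of_hodgeGroup_eq`**,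
`finrank_hodgeIsotropyLie_prod_eq_and_of_hodgeGroup_eq`.  §2 `finrank_triple_ellipticPeriod_of_ne_bot` (`(1,0,1)`),
`finrank_triple_ellipticPeriod_of_eq_bot` (`(1,2,3)`).  §3 **`finrank_hodgeIsotropyLie_prod_ellipticPeriod_le_two`**
(`dim 𝔨 ≤ 2`, `dim 𝔭 ≤ 4` for every `E_τ₁ × E_τ₂`), `finrank_hodgeIsotropyLie_prod_ellipticPeriod_eq_two_of_hodgeGroup_eq`,
**`finrank_triple_prod_ellipticPeriod_of_not_isIsogenous_of_ne_bot`** (`(2,0,2)`),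
**`finrank_triple_prod_ellipticPeriod_of_eq_bot_of_ne_bot`** / `…_of_ne_bot_of_eq_bot` (`(2,2,4)`),
**`finrank_triple_prod_ellipticPeriod_of_eq_bot_of_not_isIsogenous`** (`(2,4,6)`).  §4 `im_I_mul_sqrt_natCast_ne_zero`,
`im_I_mul_sqrt_sqrt_natCast_ne_zero`, `I_mul_sqrt_natCast_sq_add`, `finrank_triple_prod_ellipticPeriod_I_mul_sqrt_two_I_mul_sqrt_three`,
`finrank_triple_prod_ellipticPeriod_I_mul_sqrt_sqrt_two_I`, `finrank_triple_prod_ellipticPeriod_I_mul_sqrt_sqrt_two_three`.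

NOT here: isogenous factors `E × E'`, `E ∼ E'` (their `𝔥𝔤_ℝ` is the diagonal `𝔥𝔤_ℝ(E)`; g17-#4 treats the powers `Eᴺ`);
a Hodge-general surface (type `(4, 6)`); simple surfaces with real or quaternion multiplication; the `ℚ`-structure; anything
arithmetic (Sato–Tate groups, component groups).

## References

* [Imai1976HodgeGroups] H. Imai, *On the Hodge groups of some abelian varieties*, Kodai Math. Sem. Rep. 27 (1976) 367–372,
  §1 (p. 367), §2 Proposition (pp. 368–370).
* [MoonenZarhin1999LowDim] B. Moonen, Yu. G. Zarhin, *Hodge classes on abelian varieties of low dimension*, Math. Ann. 315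
  (1999) 711–733, §1, §2 (2.1), §3 Theorem and Corollary (held copy `paper:arxiv-math_9901113`, chunks p0005–p0007).
* [FiteEtAl2012] F. Fité, K. S. Kedlaya, V. Rotger, A. V. Sutherland, *Sato–Tate distributions and Galois endomorphism
  modules in genus 2*, Compositio Math. 148 (2012) 1390–1442, §3.2 Lemma 3.7, §4.2 (held copy `paper:arxiv-1110.6638`, p0011, p0014).
* K. S. Kedlaya, *Sato–Tate groups of genus 2 curves*, arXiv:1408.6968 (2014), Thm. 3.1 (held copy `paper:arxiv-1408.6968`, p0011).
* [GreenGriffithsKerr2012] M. Green, P. Griffiths, M. Kerr, *Mumford–Tate Groups and Domains* (2012), §III.B (i) (p. 72).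
* [HulekLaface2019PicardNumbersAV] K. Hulek, R. Laface, *On the Picard numbers of abelian varieties*, Ann. Sc. Norm. Super.
  Pisa (2019), §3.1 Prop. 3.1, §6.1.
* [SilvermanAEC2009] J. H. Silverman, *The Arithmetic of Elliptic Curves*, 2nd ed. (2009), Ch. VI Thm. 5.5.
-/

noncomputable section

open scoped Matrix Real

open Set Function Module Matrix NormedSpace Complex

namespace Literature.Geometry.Kaehler

namespace ComplexTorus

/-! ## §1 Products: `𝔨(X₁ × X₂) ⊆ 𝔨(X₁) ⊕ 𝔨(X₂)`, `𝔭(X₁ × X₂) ⊆ 𝔭(X₁) ⊕ 𝔭(X₂)`; equality when `Hg(X₁ × X₂) = Hg(X₁) × Hg(X₂)` -/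

section Product

variable {ι₁ ι₂ : Type*} [Fintype ι₁] [Fintype ι₂] [DecidableEq ι₁] [DecidableEq ι₂]
  {E₁ E₂ : Type*} [NormedAddCommGroup E₁] [NormedSpace ℂ E₁] [NormedAddCommGroup E₂] [NormedSpace ℂ E₂]
  (Φ₁ : (ι₁ → ℝ) ≃L[ℝ] E₁) (Φ₂ : (ι₂ → ℝ) ≃L[ℝ] E₂)

omit [DecidableEq ι₁] [DecidableEq ι₂] in
/-- Block-diagonal multiplication. [folklore] -/
private theorem fromBlocks_diag_mul_fromBlocks_diag (A A' : Matrix ι₁ ι₁ ℝ) (B B' : Matrix ι₂ ι₂ ℝ) :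
    Matrix.fromBlocks A 0 0 B * Matrix.fromBlocks A' 0 0 B' = Matrix.fromBlocks (A * A') 0 0 (B * B') := by
  rw [Matrix.fromBlocks_multiply]
  simp

/-- **The blocks of `K ∈ 𝔨(X₁ × X₂)` lie in `𝔨(X₁)`, `𝔨(X₂)`** (`J_{X₁ × X₂} = J₁ ⊕ J₂` and `𝔥𝔤_ℝ(X₁ × X₂)` is
block-diagonal, g17-#4). [cite: GreenGriffithsKerr2012, §III.B (i) (p. 72)] [cite: Imai1976HodgeGroups, §1 (p. 367: "`Hg(A₁ × A₂) ⊂ Hg(A₁) × Hg(A₂)`")] -/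
theorem exists_eq_fromBlocks_of_mem_hodgeIsotropyLie_prod {K : Matrix (ι₁ ⊕ ι₂) (ι₁ ⊕ ι₂) ℝ}
    (hK : K ∈ hodgeIsotropyLie (prodPeriod Φ₁ Φ₂)) :
    ∃ A ∈ hodgeIsotropyLie Φ₁, ∃ B ∈ hodgeIsotropyLie Φ₂, K = Matrix.fromBlocks A 0 0 B := by
  obtain ⟨hK1, hK2⟩ := (mem_hodgeIsotropyLie_iff _).1 hK
  obtain ⟨A, hA, B, hB, rfl⟩ := exists_eq_fromBlocks_of_mem_hodgeGroupLie_prod Φ₁ Φ₂ hK1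
  rw [jMatrix_prodPeriod, fromBlocks_diag_mul_fromBlocks_diag, fromBlocks_diag_mul_fromBlocks_diag] at hK2
  obtain ⟨h11, -, -, h22⟩ := Matrix.fromBlocks_inj.1 hK2
  exact ⟨A, (mem_hodgeIsotropyLie_iff _).2 ⟨hA, h11⟩, B, (mem_hodgeIsotropyLie_iff _).2 ⟨hB, h22⟩, rfl⟩

/-- **The blocks of `P ∈ 𝔭(X₁ × X₂)` lie in `𝔭(X₁)`, `𝔭(X₂)`.** [cite: GreenGriffithsKerr2012, §III.B (i) (p. 72)]
[cite: Imai1976HodgeGroups, §1 (p. 367)] -/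
theorem exists_eq_fromBlocks_of_mem_hodgeCartanP_prod {P : Matrix (ι₁ ⊕ ι₂) (ι₁ ⊕ ι₂) ℝ}
    (hP : P ∈ hodgeCartanP (prodPeriod Φ₁ Φ₂)) :
    ∃ A ∈ hodgeCartanP Φ₁, ∃ B ∈ hodgeCartanP Φ₂, P = Matrix.fromBlocks A 0 0 B := by
  obtain ⟨hP1, hP2⟩ := (mem_hodgeCartanP_iff _).1 hP
  obtain ⟨A, hA, B, hB, rfl⟩ := exists_eq_fromBlocks_of_mem_hodgeGroupLie_prod Φ₁ Φ₂ hP1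
  rw [jMatrix_prodPeriod, fromBlocks_diag_mul_fromBlocks_diag, fromBlocks_diag_mul_fromBlocks_diag,
    Matrix.fromBlocks_neg, neg_zero] at hP2
  obtain ⟨h11, -, -, h22⟩ := Matrix.fromBlocks_inj.1 hP2
  exact ⟨A, (mem_hodgeCartanP_iff _).2 ⟨hA, h11⟩, B, (mem_hodgeCartanP_iff _).2 ⟨hB, h22⟩, rfl⟩

/-- **`dim_ℝ 𝔨(X₁ × X₂) ≤ dim_ℝ 𝔨(X₁) + dim_ℝ 𝔨(X₂)`** for every pair of complex tori.
[cite: GreenGriffithsKerr2012, §III.B (i) (p. 72)] [cite: Imai1976HodgeGroups, §1 (p. 367)] -/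
theorem finrank_hodgeIsotropyLie_prod_le :
    finrank ℝ (hodgeIsotropyLie (prodPeriod Φ₁ Φ₂)) ≤
      finrank ℝ (hodgeIsotropyLie Φ₁) + finrank ℝ (hodgeIsotropyLie Φ₂) := by
  letI : LieRing (Matrix ι₁ ι₁ ℝ) := LieRing.ofAssociativeRing
  letI : LieRing (Matrix ι₂ ι₂ ℝ) := LieRing.ofAssociativeRing
  letI : LieRing (Matrix (ι₁ ⊕ ι₂) (ι₁ ⊕ ι₂) ℝ) := LieRing.ofAssociativeRing
  have h11 : ∀ Z : hodgeIsotropyLie (prodPeriod Φ₁ Φ₂),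
      (Z : Matrix (ι₁ ⊕ ι₂) (ι₁ ⊕ ι₂) ℝ).toBlocks₁₁ ∈ hodgeIsotropyLie Φ₁ ∧
        (Z : Matrix (ι₁ ⊕ ι₂) (ι₁ ⊕ ι₂) ℝ).toBlocks₂₂ ∈ hodgeIsotropyLie Φ₂ ∧
          (Z : Matrix (ι₁ ⊕ ι₂) (ι₁ ⊕ ι₂) ℝ) =
            Matrix.fromBlocks (Z : Matrix (ι₁ ⊕ ι₂) (ι₁ ⊕ ι₂) ℝ).toBlocks₁₁ 0 0
              (Z : Matrix (ι₁ ⊕ ι₂) (ι₁ ⊕ ι₂) ℝ).toBlocks₂₂ := fun Z ↦ by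
    obtain ⟨A, hA, B, hB, hZ⟩ := exists_eq_fromBlocks_of_mem_hodgeIsotropyLie_prod Φ₁ Φ₂ Z.2
    rw [hZ]
    simp only [Matrix.toBlocks_fromBlocks₁₁, Matrix.toBlocks_fromBlocks₂₂, and_true]
    exact ⟨hA, hB⟩
  let f : hodgeIsotropyLie (prodPeriod Φ₁ Φ₂) →ₗ[ℝ] hodgeIsotropyLie Φ₁ × hodgeIsotropyLie Φ₂ :=
    { toFun := fun Z ↦ (⟨_, (h11 Z).1⟩, ⟨_, (h11 Z).2.1⟩)
      map_add' := fun Z W ↦ rfl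
      map_smul' := fun c Z ↦ rfl }
  have hf : Function.Injective f := by
    intro Z W h
    apply Subtype.ext
    have h1 : (Z : Matrix (ι₁ ⊕ ι₂) (ι₁ ⊕ ι₂) ℝ).toBlocks₁₁ = (W : Matrix (ι₁ ⊕ ι₂) (ι₁ ⊕ ι₂) ℝ).toBlocks₁₁ :=
      congrArg (fun x ↦ (x.1 : Matrix ι₁ ι₁ ℝ)) h
    have h2 : (Z : Matrix (ι₁ ⊕ ι₂) (ι₁ ⊕ ι₂) ℝ).toBlocks₂₂ = (W : Matrix (ι₁ ⊕ ι₂) (ι₁ ⊕ ι₂) ℝ).toBlocks₂₂ :=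
      congrArg (fun x ↦ (x.2 : Matrix ι₂ ι₂ ℝ)) h
    rw [(h11 Z).2.2, (h11 W).2.2, h1, h2]
  have h := LinearMap.finrank_le_finrank_of_injective hf
  rwa [Module.finrank_prod] at h

/-- **`dim_ℝ 𝔭(X₁ × X₂) ≤ dim_ℝ 𝔭(X₁) + dim_ℝ 𝔭(X₂)`** for every pair of complex tori.
[cite: GreenGriffithsKerr2012, §III.B (i) (p. 72)] [cite: Imai1976HodgeGroups, §1 (p. 367)] -/
theorem finrank_hodgeCartanP_prod_le :
    finrank ℝ (hodgeCartanP (prodPeriod Φ₁ Φ₂)) ≤ finrank ℝ (hodgeCartanP Φ₁) + finrank ℝ (hodgeCartanP Φ₂) := by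
  have h11 : ∀ Z : hodgeCartanP (prodPeriod Φ₁ Φ₂),
      (Z : Matrix (ι₁ ⊕ ι₂) (ι₁ ⊕ ι₂) ℝ).toBlocks₁₁ ∈ hodgeCartanP Φ₁ ∧
        (Z : Matrix (ι₁ ⊕ ι₂) (ι₁ ⊕ ι₂) ℝ).toBlocks₂₂ ∈ hodgeCartanP Φ₂ ∧
          (Z : Matrix (ι₁ ⊕ ι₂) (ι₁ ⊕ ι₂) ℝ) =
            Matrix.fromBlocks (Z : Matrix (ι₁ ⊕ ι₂) (ι₁ ⊕ ι₂) ℝ).toBlocks₁₁ 0 0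
              (Z : Matrix (ι₁ ⊕ ι₂) (ι₁ ⊕ ι₂) ℝ).toBlocks₂₂ := fun Z ↦ by
    obtain ⟨A, hA, B, hB, hZ⟩ := exists_eq_fromBlocks_of_mem_hodgeCartanP_prod Φ₁ Φ₂ Z.2
    rw [hZ]
    simp only [Matrix.toBlocks_fromBlocks₁₁, Matrix.toBlocks_fromBlocks₂₂, and_true]
    exact ⟨hA, hB⟩
  let f : hodgeCartanP (prodPeriod Φ₁ Φ₂) →ₗ[ℝ] hodgeCartanP Φ₁ × hodgeCartanP Φ₂ :=
    { toFun := fun Z ↦ (⟨_, (h11 Z).1⟩, ⟨_, (h11 Z).2.1⟩)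
      map_add' := fun Z W ↦ rfl
      map_smul' := fun c Z ↦ rfl }
  have hf : Function.Injective f := by
    intro Z W h
    apply Subtype.ext
    have h1 : (Z : Matrix (ι₁ ⊕ ι₂) (ι₁ ⊕ ι₂) ℝ).toBlocks₁₁ = (W : Matrix (ι₁ ⊕ ι₂) (ι₁ ⊕ ι₂) ℝ).toBlocks₁₁ :=
      congrArg (fun x ↦ (x.1 : Matrix ι₁ ι₁ ℝ)) h
    have h2 : (Z : Matrix (ι₁ ⊕ ι₂) (ι₁ ⊕ ι₂) ℝ).toBlocks₂₂ = (W : Matrix (ι₁ ⊕ ι₂) (ι₁ ⊕ ι₂) ℝ).toBlocks₂₂ :=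
      congrArg (fun x ↦ (x.2 : Matrix ι₂ ι₂ ℝ)) h
    rw [(h11 Z).2.2, (h11 W).2.2, h1, h2]
  have h := LinearMap.finrank_le_finrank_of_injective hf
  rwa [Module.finrank_prod] at h

/-- **`𝔥𝔤_ℝ(X₁) ⊕ 𝔥𝔤_ℝ(X₂) ⊆ 𝔥𝔤_ℝ(X₁ × X₂)` when `Hg(X₁ × X₂) = Hg(X₁) × Hg(X₂)`**: `(A 0; 0 B)` generates the
one-parameter group `(e^{tA} 0; 0 e^{tB}) ⊆ Hg(X₁)(ℝ) × Hg(X₂)(ℝ) = Hg(X₁ × X₂)(ℝ)`.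
[cite: Imai1976HodgeGroups, §2 Proposition (p. 368)] [cite: MoonenZarhin1999LowDim, §3 Corollary] -/
theorem fromBlocks_mem_hodgeGroupLie_prod_of_hodgeGroup_eq
    (h : hodgeGroup (prodPeriod Φ₁ Φ₂) = ((hodgeGroup Φ₁).prod (hodgeGroup Φ₂)).map (blockDiag ι₁ ι₂))
    {A : Matrix ι₁ ι₁ ℝ} {B : Matrix ι₂ ι₂ ℝ} (hA : A ∈ hodgeGroupLie Φ₁) (hB : B ∈ hodgeGroupLie Φ₂) :
    Matrix.fromBlocks A 0 0 B ∈ hodgeGroupLie (prodPeriod Φ₁ Φ₂) := by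
  refine (mem_hodgeGroupLie_iff _).2 fun t ↦ ?_
  obtain ⟨P, hP, hPt⟩ := (mem_hodgeGroupLie_iff _).1 hA t
  obtain ⟨Q, hQ, hQt⟩ := (mem_hodgeGroupLie_iff _).1 hB t
  refine ⟨blockDiag ι₁ ι₂ (P, Q), ?_, ?_⟩
  · rw [h]
    exact Subgroup.mem_map.2 ⟨(P, Q), Subgroup.mem_prod.2 ⟨hP, hQ⟩, rfl⟩
  · rw [coe_blockDiag, hPt, hQt, Matrix.fromBlocks_smul, smul_zero, smul_zero]
    exact (Literature.LinearAlgebra.Matrix.exp_fromBlocks_zero (t • A) (t • B)).symm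

/-- **`dim_ℝ 𝔥𝔤_ℝ(X₁ × X₂) = dim_ℝ 𝔥𝔤_ℝ(X₁) + dim_ℝ 𝔥𝔤_ℝ(X₂)` when `Hg(X₁ × X₂) = Hg(X₁) × Hg(X₂)`.**
[cite: Imai1976HodgeGroups, §2 Proposition (p. 368)] [cite: MoonenZarhin1999LowDim, §3 Corollary] -/
theorem finrank_hodgeGroupLie_prod_eq_of_hodgeGroup_eq
    (h : hodgeGroup (prodPeriod Φ₁ Φ₂) = ((hodgeGroup Φ₁).prod (hodgeGroup Φ₂)).map (blockDiag ι₁ ι₂)) :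
    finrank ℝ (hodgeGroupLie (prodPeriod Φ₁ Φ₂)) = finrank ℝ (hodgeGroupLie Φ₁) + finrank ℝ (hodgeGroupLie Φ₂) := by
  letI : LieRing (Matrix ι₁ ι₁ ℝ) := LieRing.ofAssociativeRing
  letI : LieRing (Matrix ι₂ ι₂ ℝ) := LieRing.ofAssociativeRing
  letI : LieRing (Matrix (ι₁ ⊕ ι₂) (ι₁ ⊕ ι₂) ℝ) := LieRing.ofAssociativeRing
  refine le_antisymm (finrank_hodgeGroupLie_prod_le Φ₁ Φ₂) ?_
  let g : hodgeGroupLie Φ₁ × hodgeGroupLie Φ₂ →ₗ[ℝ] hodgeGroupLie (prodPeriod Φ₁ Φ₂) :=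
    { toFun := fun AB ↦ ⟨Matrix.fromBlocks (AB.1 : Matrix ι₁ ι₁ ℝ) 0 0 (AB.2 : Matrix ι₂ ι₂ ℝ),
        fromBlocks_mem_hodgeGroupLie_prod_of_hodgeGroup_eq Φ₁ Φ₂ h AB.1.2 AB.2.2⟩
      map_add' := fun AB CD ↦ Subtype.ext (by simp [Matrix.fromBlocks_add])
      map_smul' := fun c AB ↦ Subtype.ext (by simp [Matrix.fromBlocks_smul]) }
  have hg : Function.Injective g := by
    intro AB CD hAC
    have h' := congrArg (fun Z : hodgeGroupLie (prodPeriod Φ₁ Φ₂) ↦ (Z : Matrix (ι₁ ⊕ ι₂) (ι₁ ⊕ ι₂) ℝ)) hAC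
    obtain ⟨h1, -, -, h2⟩ := Matrix.fromBlocks_inj.1 h'
    exact Prod.ext (Subtype.ext h1) (Subtype.ext h2)
  have hle := LinearMap.finrank_le_finrank_of_injective hg
  rwa [Module.finrank_prod] at hle

/-- **`dim 𝔨(X₁ × X₂) = dim 𝔨(X₁) + dim 𝔨(X₂)` and `dim 𝔭(X₁ × X₂) = dim 𝔭(X₁) + dim 𝔭(X₂)` when
`Hg(X₁ × X₂) = Hg(X₁) × Hg(X₂)`** (both inequalities `≤` hold in general and the totals agree).
[cite: Imai1976HodgeGroups, §2 Proposition (p. 368)] [cite: MoonenZarhin1999LowDim, §3 Corollary] -/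
theorem finrank_hodgeIsotropyLie_prod_eq_and_of_hodgeGroup_eq
    (h : hodgeGroup (prodPeriod Φ₁ Φ₂) = ((hodgeGroup Φ₁).prod (hodgeGroup Φ₂)).map (blockDiag ι₁ ι₂)) :
    finrank ℝ (hodgeIsotropyLie (prodPeriod Φ₁ Φ₂)) = finrank ℝ (hodgeIsotropyLie Φ₁) + finrank ℝ (hodgeIsotropyLie Φ₂) ∧
      finrank ℝ (hodgeCartanP (prodPeriod Φ₁ Φ₂)) = finrank ℝ (hodgeCartanP Φ₁) + finrank ℝ (hodgeCartanP Φ₂) := by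
  have h0 := finrank_hodgeGroupLie_prod_eq_of_hodgeGroup_eq Φ₁ Φ₂ h
  have h1 := finrank_hodgeIsotropyLie_prod_le Φ₁ Φ₂
  have h2 := finrank_hodgeCartanP_prod_le Φ₁ Φ₂
  have h3 := finrank_hodgeGroupLie_eq_finrank_hodgeIsotropyLie_add_finrank_hodgeCartanP (prodPeriod Φ₁ Φ₂)
  have h4 := finrank_hodgeGroupLie_eq_finrank_hodgeIsotropyLie_add_finrank_hodgeCartanP Φ₁
  have h5 := finrank_hodgeGroupLie_eq_finrank_hodgeIsotropyLie_add_finrank_hodgeCartanP Φ₂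
  omega

end Product

/-! ## §2 Elliptic curves: `(dim 𝔨, dim 𝔭)(E_τ) = (1, 0)` with, `(1, 2)` without complex multiplication -/

section Elliptic

variable {τ : ℂ} (hτ : τ.im ≠ 0)

include hτ in
/-- **`(dim 𝔨, dim 𝔭, dim 𝔥𝔤_ℝ)(E_τ) = (1, 0, 1)` for a CM curve** (`𝔥𝔤_ℝ = ℝJ`; g17-#2, g18-#2).
[cite: Imai1976HodgeGroups, §2 (p. 368)] [cite: MoonenZarhin1999LowDim, §2 (2.1) (Type IV(1,1))] -/
theorem finrank_triple_ellipticPeriod_of_ne_bot (h : ellipticEnd hτ ≠ ⊥) :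
    finrank ℝ (hodgeIsotropyLie (ellipticPeriod hτ)) = 1 ∧ finrank ℝ (hodgeCartanP (ellipticPeriod hτ)) = 0 ∧
      finrank ℝ (hodgeGroupLie (ellipticPeriod hτ)) = 1 := by
  have h1 := finrank_hodgeGroupLie_ellipticPeriod_of_ne_bot hτ h
  have h2 := finrank_hodgeGroupLie_eq_finrank_hodgeIsotropyLie_add_finrank_hodgeCartanP (ellipticPeriod hτ)
  have h3 := finrank_hodgeIsotropyLie_pos (ellipticPeriod hτ)
  omega

include hτ in
/-- **`(dim 𝔨, dim 𝔭, dim 𝔥𝔤_ℝ)(E_τ) = (1, 2, 3)` for a curve without complex multiplication** (`𝔥𝔤_ℝ = 𝔰𝔩₂(ℝ)`,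
`𝔭 ≠ 0` even-dimensional). [cite: Imai1976HodgeGroups, §2 (p. 368)] [cite: MoonenZarhin1999LowDim, §2 (2.1) (Type I(1))] -/
theorem finrank_triple_ellipticPeriod_of_eq_bot (h : ellipticEnd hτ = ⊥) :
    finrank ℝ (hodgeIsotropyLie (ellipticPeriod hτ)) = 1 ∧ finrank ℝ (hodgeCartanP (ellipticPeriod hτ)) = 2 ∧
      finrank ℝ (hodgeGroupLie (ellipticPeriod hτ)) = 3 := by
  have h1 := finrank_hodgeGroupLie_ellipticPeriod_of_eq_bot hτ h
  have h2 := finrank_hodgeGroupLie_eq_finrank_hodgeIsotropyLie_add_finrank_hodgeCartanP (ellipticPeriod hτ)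
  have h3 := finrank_hodgeIsotropyLie_pos (ellipticPeriod hτ)
  have h4 := two_le_finrank_hodgeCartanP_of_ne_bot (ellipticPeriod hτ) (hodgeCartanP_ellipticPeriod_ne_bot_of_eq_bot hτ h)
  omega

end Elliptic

/-! ## §3 Products of two elliptic curves -/

section EllipticProduct

variable {τ₁ τ₂ : ℂ} (hτ₁ : τ₁.im ≠ 0) (hτ₂ : τ₂.im ≠ 0)

include hτ₁ hτ₂ in
/-- **`dim 𝔨(E_τ₁ × E_τ₂) ≤ 2`, `dim 𝔭(E_τ₁ × E_τ₂) ≤ 4`** for EVERY pair of elliptic curves — a product of two elliptic curves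
never has the isotropy algebra `𝔲(2)` (it is never Hodge-general, g17-#4).
[cite: Imai1976HodgeGroups, §1 (p. 367)] [cite: GreenGriffithsKerr2012, §III.B (i) (p. 72)] -/
theorem finrank_hodgeIsotropyLie_prod_ellipticPeriod_le_two :
    finrank ℝ (hodgeIsotropyLie (prodPeriod (ellipticPeriod hτ₁) (ellipticPeriod hτ₂))) ≤ 2 ∧
      finrank ℝ (hodgeCartanP (prodPeriod (ellipticPeriod hτ₁) (ellipticPeriod hτ₂))) ≤ 4 := by
  have h1 := finrank_hodgeIsotropyLie_prod_le (ellipticPeriod hτ₁) (ellipticPeriod hτ₂)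
  have h2 := finrank_hodgeCartanP_prod_le (ellipticPeriod hτ₁) (ellipticPeriod hτ₂)
  have hk : ∀ {τ : ℂ} (hτ : τ.im ≠ 0), finrank ℝ (hodgeIsotropyLie (ellipticPeriod hτ)) = 1 ∧
      finrank ℝ (hodgeCartanP (ellipticPeriod hτ)) ≤ 2 := fun hτ ↦ by
    by_cases h : ellipticEnd hτ = ⊥
    · have h' := finrank_triple_ellipticPeriod_of_eq_bot hτ h; omega
    · have h' := finrank_triple_ellipticPeriod_of_ne_bot hτ h; omega
  have ha := hk hτ₁
  have hb := hk hτ₂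
  omega

include hτ₁ hτ₂ in
/-- **Product Hodge group ⟹ `(dim 𝔨, dim 𝔭)(E_τ₁ × E_τ₂) = (2, dim 𝔭(E_τ₁) + dim 𝔭(E_τ₂))`**: whenever
`Hg(E_τ₁ × E_τ₂) = Hg(E_τ₁) × Hg(E_τ₂)` (non-isogenous curves, Imai / Moonen–Zarhin), `𝔥𝔤_ℝ(E_τ₁ × E_τ₂) = 𝔥𝔤_ℝ(E_τ₁) ⊕ 𝔥𝔤_ℝ(E_τ₂)`
with isotropy `ℝJ₁ ⊕ ℝJ₂`. [cite: Imai1976HodgeGroups, §2 Proposition (p. 368)] [cite: MoonenZarhin1999LowDim, §3 Corollary] -/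
theorem finrank_hodgeIsotropyLie_prod_ellipticPeriod_eq_two_of_hodgeGroup_eq
    (h : hodgeGroup (prodPeriod (ellipticPeriod hτ₁) (ellipticPeriod hτ₂)) =
      ((hodgeGroup (ellipticPeriod hτ₁)).prod (hodgeGroup (ellipticPeriod hτ₂))).map (blockDiag (Fin 2) (Fin 2))) :
    finrank ℝ (hodgeIsotropyLie (prodPeriod (ellipticPeriod hτ₁) (ellipticPeriod hτ₂))) = 2 ∧
      finrank ℝ (hodgeCartanP (prodPeriod (ellipticPeriod hτ₁) (ellipticPeriod hτ₂))) =
        finrank ℝ (hodgeCartanP (ellipticPeriod hτ₁)) + finrank ℝ (hodgeCartanP (ellipticPeriod hτ₂)) := by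
  have h0 := finrank_hodgeIsotropyLie_prod_eq_and_of_hodgeGroup_eq (ellipticPeriod hτ₁) (ellipticPeriod hτ₂) h
  have hk : ∀ {τ : ℂ} (hτ : τ.im ≠ 0), finrank ℝ (hodgeIsotropyLie (ellipticPeriod hτ)) = 1 := fun hτ ↦ by
    by_cases h : ellipticEnd hτ = ⊥
    · exact (finrank_triple_ellipticPeriod_of_eq_bot hτ h).1
    · exact (finrank_triple_ellipticPeriod_of_ne_bot hτ h).1
  have ha := hk hτ₁
  have hb := hk hτ₂
  omega

include hτ₁ hτ₂ in
/-- **TYPE `𝔲(1)²` = `(2, 0)`: two NON-ISOGENOUS CM curves** — `Hg(E_τ₁ × E_τ₂) = U_{F₁} × U_{F₂}`,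
`𝔥𝔤_ℝ = ℝJ₁ ⊕ ℝJ₂`, `dim 𝔥𝔤_ℝ = 2` ("`E₁ × E'₁`": connected Sato–Tate group `U(1) × U(1)`).
[cite: Imai1976HodgeGroups, §2 Proposition (p. 368)] [cite: MoonenZarhin1999LowDim, §3 Corollary] [cite: FiteEtAl2012, §3.2 Lemma 3.7 and §4.2 (type **D**)] -/
theorem finrank_triple_prod_ellipticPeriod_of_not_isIsogenous_of_ne_bot {p₁ q₁ p₂ q₂ : ℚ}
    (hq₁ : τ₁ ^ 2 + p₁ * τ₁ + q₁ = 0) (hq₂ : τ₂ ^ 2 + p₂ * τ₂ + q₂ = 0)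
    (h : ¬ IsIsogenous (ellipticPeriod hτ₁) (ellipticPeriod hτ₂)) :
    finrank ℝ (hodgeIsotropyLie (prodPeriod (ellipticPeriod hτ₁) (ellipticPeriod hτ₂))) = 2 ∧
      finrank ℝ (hodgeCartanP (prodPeriod (ellipticPeriod hτ₁) (ellipticPeriod hτ₂))) = 0 ∧
        finrank ℝ (hodgeGroupLie (prodPeriod (ellipticPeriod hτ₁) (ellipticPeriod hτ₂))) = 2 := by
  have hH := hodgeGroup_prod_ellipticPeriod_eq_of_not_isIsogenous hτ₁ hτ₂ hq₁ hq₂ h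
  have h0 := finrank_hodgeIsotropyLie_prod_ellipticPeriod_eq_two_of_hodgeGroup_eq hτ₁ hτ₂ hH
  have h1 := finrank_triple_ellipticPeriod_of_ne_bot hτ₁ ((ellipticEnd_ne_bot_iff hτ₁).2 ⟨p₁, q₁, hq₁⟩)
  have h2 := finrank_triple_ellipticPeriod_of_ne_bot hτ₂ ((ellipticEnd_ne_bot_iff hτ₂).2 ⟨p₂, q₂, hq₂⟩)
  have h3 := finrank_hodgeGroupLie_eq_finrank_hodgeIsotropyLie_add_finrank_hodgeCartanP
    (prodPeriod (ellipticPeriod hτ₁) (ellipticPeriod hτ₂))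
  omega

include hτ₁ hτ₂ in
/-- **TYPE `𝔲(1) ⊕ 𝔰𝔩₂(ℝ)` = `(2, 2)`: a curve WITHOUT and a curve WITH complex multiplication** —
`Hg(E_τ₁ × E_τ₂) = SL₂ × U_F`, `dim 𝔥𝔤_ℝ = 4` ("`E₁ × E₂`": connected Sato–Tate group `U(1) × SU(2)`).
[cite: Imai1976HodgeGroups, §2 Proposition (pp. 368, 370)] [cite: MoonenZarhin1999LowDim, §3 Theorem (2) and Corollary] [cite: FiteEtAl2012, §3.2 Lemma 3.7 and §4.2 (type **C**)] -/
theorem finrank_triple_prod_ellipticPeriod_of_eq_bot_of_ne_bot (h₁ : ellipticEnd hτ₁ = ⊥) (h₂ : ellipticEnd hτ₂ ≠ ⊥) :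
    finrank ℝ (hodgeIsotropyLie (prodPeriod (ellipticPeriod hτ₁) (ellipticPeriod hτ₂))) = 2 ∧
      finrank ℝ (hodgeCartanP (prodPeriod (ellipticPeriod hτ₁) (ellipticPeriod hτ₂))) = 2 ∧
        finrank ℝ (hodgeGroupLie (prodPeriod (ellipticPeriod hτ₁) (ellipticPeriod hτ₂))) = 4 := by
  have hH := hodgeGroup_prod_ellipticPeriod_eq_of_eq_bot_of_ne_bot hτ₁ hτ₂ h₁ h₂
  have h0 := finrank_hodgeIsotropyLie_prod_ellipticPeriod_eq_two_of_hodgeGroup_eq hτ₁ hτ₂ hH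
  have ha := finrank_triple_ellipticPeriod_of_eq_bot hτ₁ h₁
  have hb := finrank_triple_ellipticPeriod_of_ne_bot hτ₂ h₂
  have h3 := finrank_hodgeGroupLie_eq_finrank_hodgeIsotropyLie_add_finrank_hodgeCartanP
    (prodPeriod (ellipticPeriod hτ₁) (ellipticPeriod hτ₂))
  omega

include hτ₁ hτ₂ in
/-- The symmetric case: CM × non-CM is `(2, 2)` as well. [cite: Imai1976HodgeGroups, §2 Proposition (pp. 368, 370)]
[cite: MoonenZarhin1999LowDim, §3 Theorem (2) and Corollary] -/
theorem finrank_triple_prod_ellipticPeriod_of_ne_bot_of_eq_bot (h₁ : ellipticEnd hτ₁ ≠ ⊥) (h₂ : ellipticEnd hτ₂ = ⊥) :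
    finrank ℝ (hodgeIsotropyLie (prodPeriod (ellipticPeriod hτ₁) (ellipticPeriod hτ₂))) = 2 ∧
      finrank ℝ (hodgeCartanP (prodPeriod (ellipticPeriod hτ₁) (ellipticPeriod hτ₂))) = 2 ∧
        finrank ℝ (hodgeGroupLie (prodPeriod (ellipticPeriod hτ₁) (ellipticPeriod hτ₂))) = 4 := by
  have hH := hodgeGroup_prod_ellipticPeriod_eq_of_ne_bot_of_eq_bot hτ₁ hτ₂ h₁ h₂
  have h0 := finrank_hodgeIsotropyLie_prod_ellipticPeriod_eq_two_of_hodgeGroup_eq hτ₁ hτ₂ hH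
  have ha := finrank_triple_ellipticPeriod_of_ne_bot hτ₁ h₁
  have hb := finrank_triple_ellipticPeriod_of_eq_bot hτ₂ h₂
  have h3 := finrank_hodgeGroupLie_eq_finrank_hodgeIsotropyLie_add_finrank_hodgeCartanP
    (prodPeriod (ellipticPeriod hτ₁) (ellipticPeriod hτ₂))
  omega

include hτ₁ hτ₂ in
/-- **TYPE `𝔰𝔩₂(ℝ)²` = `(2, 4)`: two NON-ISOGENOUS curves WITHOUT complex multiplication** —
`Hg(E_τ₁ × E_τ₂) = SL₂ × SL₂`, `dim 𝔥𝔤_ℝ = 6` ("`E₂ × E'₂`": connected Sato–Tate group `SU(2) × SU(2)`).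
[cite: Imai1976HodgeGroups, §2 Proposition (pp. 368–370)] [cite: MoonenZarhin1999LowDim, §3 Corollary] [cite: FiteEtAl2012, §3.2 Lemma 3.7 and §4.2 (type **B**)] -/
theorem finrank_triple_prod_ellipticPeriod_of_eq_bot_of_not_isIsogenous (h₁ : ellipticEnd hτ₁ = ⊥)
    (h₂ : ellipticEnd hτ₂ = ⊥) (h : ¬ IsIsogenous (ellipticPeriod hτ₁) (ellipticPeriod hτ₂)) :
    finrank ℝ (hodgeIsotropyLie (prodPeriod (ellipticPeriod hτ₁) (ellipticPeriod hτ₂))) = 2 ∧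
      finrank ℝ (hodgeCartanP (prodPeriod (ellipticPeriod hτ₁) (ellipticPeriod hτ₂))) = 4 ∧
        finrank ℝ (hodgeGroupLie (prodPeriod (ellipticPeriod hτ₁) (ellipticPeriod hτ₂))) = 6 := by
  have hH := hodgeGroup_prod_eq_of_homRat_eq_bot (ellipticPeriod hτ₁) (ellipticPeriod hτ₂)
    ((endAlgRat_ellipticPeriod_eq_bot_iff hτ₁).2 h₁) ((endAlgRat_ellipticPeriod_eq_bot_iff hτ₂).2 h₂)
    (homRat_ellipticPeriod_eq_bot_of_not_isIsogenous hτ₁ hτ₂ h)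
  have h0 := finrank_hodgeIsotropyLie_prod_ellipticPeriod_eq_two_of_hodgeGroup_eq hτ₁ hτ₂ hH
  have ha := finrank_triple_ellipticPeriod_of_eq_bot hτ₁ h₁
  have hb := finrank_triple_ellipticPeriod_of_eq_bot hτ₂ h₂
  have h3 := finrank_hodgeGroupLie_eq_finrank_hodgeIsotropyLie_add_finrank_hodgeCartanP
    (prodPeriod (ellipticPeriod hτ₁) (ellipticPeriod hτ₂))
  omega

end EllipticProduct

/-! ## §4 Explicit surfaces: `E_{i√2} × E_{i√3}` (2,0), `E_{i·2^{1/4}} × E_i` (2,2), `E_{i·2^{1/4}} × E_{i·3^{1/4}}` (2,4) -/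

section Examples

/-- `Im(i√m) > 0` for `m ≥ 1`. [cite: HulekLaface2019PicardNumbersAV, §3.1] -/
theorem im_I_mul_sqrt_natCast_ne_zero {m : ℕ} (hm : 0 < m) : (I * (Real.sqrt m : ℂ)).im ≠ 0 := by
  rw [I_mul_im, ofReal_re]
  exact (Real.sqrt_pos.2 (by exact_mod_cast hm)).ne'

/-- `Im(i·m^{1/4}) > 0` for `m ≥ 1`. [cite: HulekLaface2019PicardNumbersAV, §6.1] -/
theorem im_I_mul_sqrt_sqrt_natCast_ne_zero {m : ℕ} (hm : 0 < m) : (I * (Real.sqrt (Real.sqrt m) : ℂ)).im ≠ 0 := by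
  rw [I_mul_im, ofReal_re]
  exact (Real.sqrt_pos.2 (Real.sqrt_pos.2 (by exact_mod_cast hm))).ne'

/-- `i√m` satisfies `τ² + m = 0` (complex multiplication by `ℚ(√-m)`). [cite: SilvermanAEC2009, Ch. VI Thm. 5.5] -/
theorem I_mul_sqrt_natCast_sq_add (m : ℕ) :
    (I * (Real.sqrt m : ℂ)) ^ 2 + ((0 : ℚ) : ℂ) * (I * (Real.sqrt m : ℂ)) + ((m : ℚ) : ℂ) = 0 := by
  have hs : ((Real.sqrt m : ℝ) : ℂ) ^ 2 = (m : ℂ) := by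
    rw [← Complex.ofReal_pow, Real.sq_sqrt (Nat.cast_nonneg m), Complex.ofReal_natCast]
  rw [mul_pow, Complex.I_sq, hs]
  push_cast
  ring

/-- **`E_{i√2} × E_{i√3}`: type `(2, 0)`, `dim 𝔥𝔤_ℝ = 2`** (two non-isogenous CM curves, `√6 ∉ ℚ`).
[cite: FiteEtAl2012, §3.2 Lemma 3.7 and §4.2 (type **D**)] [cite: MoonenZarhin1999LowDim, §3 Corollary] -/
theorem finrank_triple_prod_ellipticPeriod_I_mul_sqrt_two_I_mul_sqrt_three :
    finrank ℝ (hodgeIsotropyLie (prodPeriod (ellipticPeriod (im_I_mul_sqrt_natCast_ne_zero (m := 2) two_pos))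
      (ellipticPeriod (im_I_mul_sqrt_natCast_ne_zero (m := 3) three_pos)))) = 2 ∧
    finrank ℝ (hodgeCartanP (prodPeriod (ellipticPeriod (im_I_mul_sqrt_natCast_ne_zero (m := 2) two_pos))
      (ellipticPeriod (im_I_mul_sqrt_natCast_ne_zero (m := 3) three_pos)))) = 0 ∧
    finrank ℝ (hodgeGroupLie (prodPeriod (ellipticPeriod (im_I_mul_sqrt_natCast_ne_zero (m := 2) two_pos))
      (ellipticPeriod (im_I_mul_sqrt_natCast_ne_zero (m := 3) three_pos)))) = 2 :=
  finrank_triple_prod_ellipticPeriod_of_not_isIsogenous_of_ne_bot _ _ (I_mul_sqrt_natCast_sq_add 2)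
    (I_mul_sqrt_natCast_sq_add 3) (not_isIsogenous_ellipticPeriod_I_mul_sqrt
      (by rintro ⟨r, hr⟩; have hr3 : r < 3 := by nlinarith
          interval_cases r <;> omega) _ _)

/-- **`E_{i·2^{1/4}} × E_i`: type `(2, 2)`, `dim 𝔥𝔤_ℝ = 4`** (no CM × CM).
[cite: FiteEtAl2012, §3.2 Lemma 3.7 and §4.2 (type **C**)] [cite: MoonenZarhin1999LowDim, §3 Theorem (2)] -/
theorem finrank_triple_prod_ellipticPeriod_I_mul_sqrt_sqrt_two_I :
    finrank ℝ (hodgeIsotropyLie (prodPeriod (ellipticPeriod im_I_mul_sqrt_sqrt_two_ne_zero)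
      (ellipticPeriod (τ := I) (by simp)))) = 2 ∧
    finrank ℝ (hodgeCartanP (prodPeriod (ellipticPeriod im_I_mul_sqrt_sqrt_two_ne_zero)
      (ellipticPeriod (τ := I) (by simp)))) = 2 ∧
    finrank ℝ (hodgeGroupLie (prodPeriod (ellipticPeriod im_I_mul_sqrt_sqrt_two_ne_zero)
      (ellipticPeriod (τ := I) (by simp)))) = 4 :=
  finrank_triple_prod_ellipticPeriod_of_eq_bot_of_ne_bot _ _ ellipticEnd_I_mul_sqrt_sqrt_two_eq_bot
    ((ellipticEnd_ne_bot_iff _).2 ⟨0, 1, by simp [sq, I_mul_I]⟩)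

/-- **`E_{i·2^{1/4}} × E_{i·3^{1/4}}`: type `(2, 4)`, `dim 𝔥𝔤_ℝ = 6`** (two non-isogenous curves without CM).
[cite: FiteEtAl2012, §3.2 Lemma 3.7 and §4.2 (type **B**)] [cite: MoonenZarhin1999LowDim, §3 Corollary] -/
theorem finrank_triple_prod_ellipticPeriod_I_mul_sqrt_sqrt_two_three :
    finrank ℝ (hodgeIsotropyLie (prodPeriod (ellipticPeriod (im_I_mul_sqrt_sqrt_natCast_ne_zero (m := 2) two_pos))
      (ellipticPeriod (im_I_mul_sqrt_sqrt_natCast_ne_zero (m := 3) three_pos)))) = 2 ∧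
    finrank ℝ (hodgeCartanP (prodPeriod (ellipticPeriod (im_I_mul_sqrt_sqrt_natCast_ne_zero (m := 2) two_pos))
      (ellipticPeriod (im_I_mul_sqrt_sqrt_natCast_ne_zero (m := 3) three_pos)))) = 4 ∧
    finrank ℝ (hodgeGroupLie (prodPeriod (ellipticPeriod (im_I_mul_sqrt_sqrt_natCast_ne_zero (m := 2) two_pos))
      (ellipticPeriod (im_I_mul_sqrt_sqrt_natCast_ne_zero (m := 3) three_pos)))) = 6 :=
  finrank_triple_prod_ellipticPeriod_of_eq_bot_of_not_isIsogenous _ _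
    (ellipticEnd_I_mul_sqrt_sqrt_eq_bot Nat.prime_two.irrational_sqrt _)
    (ellipticEnd_I_mul_sqrt_sqrt_eq_bot Nat.prime_three.irrational_sqrt _)
    (not_isIsogenous_ellipticPeriod_I_mul_sqrt_sqrt_two_three _ _)

end Examples

end ComplexTorus

end Literature.Geometry.Kaehler
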